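import Summits.NavierStokesRegularity.NavierStokesRegularity.Theorems.ClockStretchingLawSteadySliceLiouville
import Literature.Analysis.FluidPDE.KNSSSmoothingHolds
import Literature.Analysis.FluidPDE.KNSSOseenMildDecayTools
import HarnessLib

/-!
# Route ClockStretchingLaw — crux `ClockCeiling`, stub `stub_boostLiouville`

Helper file for item stmt-NavierStokesRegularity-10570 (`ClockCeiling`, line `registered`) of
route `ClockStretchingLaw` of `NavierStokesRegularity`: the travelling-wave twin of the landed
`SteadySliceLiouville`. An element `u` of the route's Type-I class (jointly smooth on
`(-∞,0) × ℝ³`, divergence free, KNSS-mild Oseen identity between all pairs of negative times,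
`‖u(t,x)‖ ≤ C/√(-t)`, local energies) with ONE Galilean-steady instant
`c₀√(-t₀) ∂ₜu(t₀,·) + ∂_b u(t₀,·) ≡ 0`, `c₀ ≠ 0`, `t₀ < 0`, vanishes identically.

Proof, with `w = b/(c₀√(-t₀))`: a sup bound on `∇²u(t₀)` (KNSS 2009 Prop. 4.1,
`knss2009_smoothing_holds`) and Dong–Zhang's bound on `∂ₜ²u` (`exists_bound_iteratedDeriv_two`)
give `‖u(t₀+h, x+hw) - u(t₀,x)‖ ≤ Ah²` (`boost_quadratic_closeness`); `u` and its space-time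
translate `u(·+h, ·+hw)` solve the Oseen integral equation from `t₀` with free terms at distance
`≤ Ah²`, so the stability window `exists_oseenMild_stability_window` (KNSS 2009 §4) gives
`‖u(t,x) - u(t+h,x+hw)‖ ≤ 2Ah²` shortly after `t₀` (`boost_stability_window`), hence
`D(uncurry u)(t,x)(1,w) = 0` there (`boost_fderiv_uncurry_eq_zero`); the travelling-wave curves
`s ↦ u(s, x₀ + (s-t₀)w)` are real-analytic on `(-∞,0)` (`analyticOnNhd_uncurry_of_oseenMild`,
Lemarié-Rieusset 2016 Thm. 9.12), locally constant, hence constant, and the Type-I bound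
`C/√(-s) → 0` (`s → -∞`) kills the constant.

References: H. Dong, Q. S. Zhang, J. Funct. Anal. 279 (2020) 108563, §3 Thm. 2;
P. G. Lemarié-Rieusset, *The Navier–Stokes Problem in the 21st Century* (2016), Thm. 9.12;
G. Koch, N. Nadirashvili, G. Seregin, V. Šverák, Acta Math. 203 (2009), §4, Prop. 4.1.
-/

set_option linter.dupNamespace false

noncomputable section

open Literature.Analysis.FluidPDE MeasureTheory Set Function Filter Topology
open Literature.Analysis.UnboundedOperators (heatExtension heatKernel heatExtension_sub_of_bound
  norm_heatExtension_le)
open scoped ENNReal NNReal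

namespace Summit.NavierStokesRegularity.NavierStokesRegularity.Theorems

section Boost

variable {C : ℝ} {u : ℝ → (EuclideanSpace ℝ (Fin 3)) → (EuclideanSpace ℝ (Fin 3))}

/-- **Sup bound on `∇²u(t₀)`** for a bounded smooth KNSS-mild ancient solution (KNSS 2009,
Prop. 4.1, `knss2009_smoothing_holds` with `(k,l) = (2,0)` on the window `(2t₀, t₀/2) ∋ t₀`; the
canonical representative `e^{(t-s)Δ}u(s) - B¹_s(u,u)(t)` is `u(t)` itself by the Oseen identity),
in the operator-norm form `‖D(Du(t₀))(y)‖ ≤ B₂`. -/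
theorem boost_exists_bound_fderiv_fderiv
    (hsm : ContDiffOn ℝ (⊤ : ℕ∞) (uncurry u) (Iio 0 ×ˢ univ))
    (hmildO : ∀ s t : ℝ, s < t → t < 0 → ∀ x,
      u t x = heatExtension (u s) (t - s) x - oseenDuhamel 1 s u u t x)
    (hTI : HasTypeITimeDecay C u) {t₀ : ℝ} (ht₀ : t₀ < 0) :
    ∃ B₂ : ℝ, ∀ y, ‖fderiv ℝ (fderiv ℝ (u t₀)) y‖ ≤ B₂ := by
  have hC : 0 ≤ C := steadySlice_typeI_const_nonneg hTI
  have h1 : 2 * t₀ < t₀ / 2 := by linarith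
  have h2 : t₀ / 2 < 0 := by linarith
  have hsup : ∀ τ ≤ t₀ / 2, eLpNorm (u τ) ∞ volume ≤ ENNReal.ofReal (C / Real.sqrt (-(t₀ / 2))) :=
    fun τ hτ => by
    rw [eLpNorm_exponent_top]
    exact eLpNormEssSup_le_of_ae_bound (Eventually.of_forall fun y =>
      steadySlice_norm_le_of_hasTypeITimeDecay hTI hC h2 hτ y)
  have hum : AEStronglyMeasurable (uncurry u) ((volume : Measure
      (ℝ × (EuclideanSpace ℝ (Fin 3)))).restrict (Ioo (2 * t₀) (t₀ / 2) ×ˢ univ)) :=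
    (hsm.continuousOn.mono (prod_mono (fun τ hτ => (hτ.2.trans h2 : τ < 0))
      Subset.rfl)).aestronglyMeasurable (measurableSet_Ioo.prod MeasurableSet.univ)
  have hfix : ∀ t ∈ Ioo (2 * t₀) (t₀ / 2), u t =ᵐ[volume] fun x =>
      heatExtension (u (2 * t₀)) (1 * (t - 2 * t₀)) x - oseenDuhamel 1 (2 * t₀) u u t x :=
    fun t ht => Eventually.of_forall fun x => by
      rw [one_mul]
      exact hmildO _ t ht.1 (ht.2.trans h2) x
  obtain ⟨-, -, hder⟩ := knss2009_smoothing_holds (EuclideanSpace ℝ (Fin 3)) one_pos h1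
    (div_nonneg hC (Real.sqrt_nonneg _))
    (steadySlice_continuous_slice hsm (h1.trans h2)).aestronglyMeasurable (hsup _ h1.le) hum
    (fun t ht => hsup t ht.2.le) hfix
  obtain ⟨K, hK⟩ := hder 2 0
  refine ⟨K / (t₀ - 2 * t₀), fun y => ?_⟩
  have key := hK t₀ ⟨by linarith, by linarith⟩ y
  have hrep : (fun z => iteratedDeriv 0 (fun τ => heatExtension (u (2 * t₀)) (1 * (τ - 2 * t₀)) z -
      oseenDuhamel 1 (2 * t₀) u u τ z) t₀) = u t₀ := by
    funext z
    rw [iteratedDeriv_zero, one_mul]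
    exact (hmildO _ t₀ (by linarith) ht₀ z).symm
  have hexp : (t₀ - 2 * t₀) ^ (((2 : ℕ) : ℝ) / 2 + ((0 : ℕ) : ℝ)) = t₀ - 2 * t₀ := by norm_num
  rw [hrep, hexp] at key
  rw [← norm_iteratedFDeriv_one (𝕜 := ℝ) (fderiv ℝ (u t₀)), norm_iteratedFDeriv_fderiv,
    le_div_iff₀ (by linarith : (0 : ℝ) < t₀ - 2 * t₀), mul_comm]
  exact key

/-- **Taylor remainder with the linear term** (mean value inequality for `s ↦ f(s) - s • f'(a)`):
if `‖f'(s) - f'(a)‖ ≤ K` on `[a, b)` then `‖f(b) - f(a) - (b - a) • f'(a)‖ ≤ K (b - a)`. -/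
theorem boost_norm_sub_sub_smul_le {f f' : ℝ → EuclideanSpace ℝ (Fin 3)} {a b K : ℝ}
    (hab : a ≤ b) (hf : ∀ s ∈ Icc a b, HasDerivAt f (f' s) s)
    (hK : ∀ s ∈ Ico a b, ‖f' s - f' a‖ ≤ K) :
    ‖f b - f a - (b - a) • f' a‖ ≤ K * (b - a) := by
  have hsd : ∀ s : ℝ, HasDerivAt (fun s : ℝ => s • f' a) (f' a) s := fun s => by
    simpa using (hasDerivAt_id s).smul_const (f' a)
  have h := norm_image_sub_le_of_norm_deriv_le_segment' (f := fun s => f s - s • f' a)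
    (f' := fun s => f' s - f' a) (fun s hs => ((hf s hs).sub (hsd s)).hasDerivWithinAt) hK b
    (right_mem_Icc.2 hab)
  calc ‖f b - f a - (b - a) • f' a‖ = ‖f b - b • f' a - (f a - a • f' a)‖ := by
        congr 1; rw [sub_smul]; abel
    _ ≤ K * (b - a) := h

/-- **Quadratic closeness at a Galilean-steady instant.** If `∂ₜu(t₀,·) + ∂_w u(t₀,·) ≡ 0` then
`‖u(t₀ + h, x + hw) - u(t₀, x)‖ ≤ A h²` for `0 < h ≤ h₀` and all `x`, by the three-term split
`[u(t₀+h,y) - u(t₀,y) - h∂ₜu(t₀,y)] + [u(t₀,y) - u(t₀,x) - h∂_w u(t₀,x)] + h[∂ₜu(t₀,y) + ∂_w u(t₀,x)]`,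
`y = x + hw`: Taylor in time (Dong–Zhang's bound on `∂ₜ²u`, `exists_bound_iteratedDeriv_two`),
Taylor along the segment `r ↦ x + rw`, and the hypothesis at `y` with the Lipschitz bound of
`r ↦ ∂_w u(t₀, x + rw)` (sup bound on `∇²u(t₀)`, `boost_exists_bound_fderiv_fderiv`). -/
theorem boost_quadratic_closeness
    (hsm : ContDiffOn ℝ (⊤ : ℕ∞) (uncurry u) (Iio 0 ×ˢ univ))
    (hdiv : ∀ t < 0, VectorCalculus.IsDivFree (u t))
    (hmildO : ∀ s t : ℝ, s < t → t < 0 → ∀ x,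
      u t x = heatExtension (u s) (t - s) x - oseenDuhamel 1 s u u t x)
    (hTI : HasTypeITimeDecay C u) {t₀ : ℝ} (ht₀ : t₀ < 0) {w : EuclideanSpace ℝ (Fin 3)}
    (H0 : ∀ y, deriv (fun s => u s y) t₀ + fderiv ℝ (u t₀) y w = 0) :
    ∃ A h₀ : ℝ, 0 ≤ A ∧ 0 < h₀ ∧ t₀ + h₀ < 0 ∧
      ∀ h : ℝ, 0 < h → h ≤ h₀ → ∀ x, ‖u (t₀ + h) (x + h • w) - u t₀ x‖ ≤ A * h ^ 2 := by
  obtain ⟨A₂, h₀, hh₀, hth₀, hA₂⟩ := exists_bound_iteratedDeriv_two hsm hdiv hmildO hTI ht₀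
  obtain ⟨B₂, hB₂⟩ := boost_exists_bound_fderiv_fderiv hsm hmildO hTI ht₀
  have hA₂0 : 0 ≤ A₂ := (norm_nonneg _).trans (hA₂ t₀ ⟨le_rfl, by linarith⟩ 0)
  have hB₂0 : 0 ≤ B₂ := le_trans (norm_nonneg (fderiv ℝ (fderiv ℝ (u t₀)) 0)) (hB₂ 0)
  set L : ℝ := B₂ * ‖w‖ ^ 2 with hL
  have hL0 : 0 ≤ L := by positivity
  refine ⟨A₂ + 2 * L, h₀, by positivity, hh₀, hth₀, fun h hh hhh₀ x => ?_⟩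
  -- smoothness of the slice `u t₀` and the derivatives along the segment `r ↦ x + r • w`
  have hslice : ContDiff ℝ (⊤ : ℕ∞) (u t₀) :=
    hsm.comp_contDiff (contDiff_prodMk_right t₀) fun z => mk_mem_prod ht₀ (mem_univ z)
  have hD1 : ∀ z, HasFDerivAt (u t₀) (fderiv ℝ (u t₀) z) z := fun z =>
    ((hslice.differentiable (by simp)) z).hasFDerivAt
  have hD2 : ∀ z, HasFDerivAt (fderiv ℝ (u t₀)) (fderiv ℝ (fderiv ℝ (u t₀)) z) z := fun z =>
    (((hslice.fderiv_right (m := (⊤ : ℕ∞)) le_rfl).differentiable (by simp)) z).hasFDerivAt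
  have hcurve : ∀ r : ℝ, HasDerivAt (fun r : ℝ => x + r • w) w r := fun r => by
    simpa using ((hasDerivAt_id r).smul_const w).const_add x
  have hφ : ∀ r : ℝ, HasDerivAt (fun r : ℝ => u t₀ (x + r • w)) (fderiv ℝ (u t₀) (x + r • w) w) r :=
    fun r => (hD1 (x + r • w)).comp_hasDerivAt r (hcurve r)
  have hψ : ∀ r : ℝ, HasDerivAt (fun r : ℝ => fderiv ℝ (u t₀) (x + r • w) w)
      (fderiv ℝ (fderiv ℝ (u t₀)) (x + r • w) w w) r := fun r => by
    have h1 : HasDerivAt (fun r : ℝ => fderiv ℝ (u t₀) (x + r • w))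
        (fderiv ℝ (fderiv ℝ (u t₀)) (x + r • w) w) r :=
      (hD2 (x + r • w)).comp_hasDerivAt r (hcurve r)
    simpa using h1.clm_apply (hasDerivAt_const r w)
  have hψbd : ∀ r : ℝ, ‖fderiv ℝ (fderiv ℝ (u t₀)) (x + r • w) w w‖ ≤ L := fun r => by
    calc ‖fderiv ℝ (fderiv ℝ (u t₀)) (x + r • w) w w‖
        ≤ ‖fderiv ℝ (fderiv ℝ (u t₀)) (x + r • w)‖ * ‖w‖ * ‖w‖ :=
          (fderiv ℝ (fderiv ℝ (u t₀)) (x + r • w) w).le_of_opNorm_le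
            ((fderiv ℝ (fderiv ℝ (u t₀)) (x + r • w)).le_opNorm w) w
      _ ≤ B₂ * ‖w‖ * ‖w‖ := by gcongr; exact hB₂ _
      _ = L := by rw [hL]; ring
  -- Lipschitz bound of `r ↦ ∂_w u(t₀, x + r w)` from `r = 0`
  have hLip : ∀ r : ℝ, 0 ≤ r →
      ‖fderiv ℝ (u t₀) (x + r • w) w - fderiv ℝ (u t₀) x w‖ ≤ L * r := by
    intro r hr
    have h1 := norm_image_sub_le_of_norm_deriv_le_segment'
      (f := fun ρ : ℝ => fderiv ℝ (u t₀) (x + ρ • w) w)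
      (f' := fun ρ => fderiv ℝ (fderiv ℝ (u t₀)) (x + ρ • w) w w) (a := 0) (b := r) (C := L)
      (fun ρ _ => (hψ ρ).hasDerivWithinAt) (fun ρ _ => hψbd ρ) r ⟨hr, le_rfl⟩
    simpa only [zero_smul, add_zero, sub_zero] using h1
  -- (1) Taylor in time at `x + h • w`
  have h1 : ‖u (t₀ + h) (x + h • w) - u t₀ (x + h • w) -
      (t₀ + h - t₀) • deriv (fun s => u s (x + h • w)) t₀‖ ≤ A₂ * h * (t₀ + h - t₀) := by
    refine boost_norm_sub_sub_smul_le (f := fun s => u s (x + h • w))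
      (f' := deriv fun s => u s (x + h • w)) (by linarith)
      (fun σ hσ => (steadySlice_hasDerivAt_curve hsm (x + h • w) (by linarith [hσ.2])).1)
      fun σ hσ => ?_
    have h2 := norm_image_sub_le_of_norm_deriv_le_segment' (f := deriv fun s => u s (x + h • w))
      (f' := iteratedDeriv 2 fun s => u s (x + h • w)) (a := t₀) (b := t₀ + h₀) (C := A₂)
      (fun σ hσ => ((steadySlice_hasDerivAt_curve hsm (x + h • w) (by linarith [hσ.2])).2).hasDerivWithinAt)
      (fun σ hσ => hA₂ σ (Ico_subset_Icc_self hσ) (x + h • w)) σ ⟨hσ.1, by linarith [hσ.2]⟩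
    exact h2.trans (mul_le_mul_of_nonneg_left (by linarith [hσ.2]) hA₂0)
  -- (2) Taylor along the segment
  have h2 : ‖u t₀ (x + h • w) - u t₀ (x + (0 : ℝ) • w) -
      (h - 0) • fderiv ℝ (u t₀) (x + (0 : ℝ) • w) w‖ ≤ L * h * (h - 0) :=
    boost_norm_sub_sub_smul_le (f := fun r : ℝ => u t₀ (x + r • w))
      (f' := fun r : ℝ => fderiv ℝ (u t₀) (x + r • w) w) hh.le (fun ρ _ => hφ ρ) fun ρ hρ => by
        simpa only [zero_smul, add_zero] using
          (hLip ρ hρ.1).trans (mul_le_mul_of_nonneg_left hρ.2.le hL0)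
  simp only [zero_smul, add_zero, sub_zero, add_sub_cancel_left] at h1 h2
  -- (3) the cross term, by the hypothesis at `x + h • w`
  have h3 : ‖h • (deriv (fun s => u s (x + h • w)) t₀ + fderiv ℝ (u t₀) x w)‖ ≤ h * (L * h) := by
    rw [eq_neg_of_add_eq_zero_left (H0 (x + h • w)), neg_add_eq_sub, norm_smul,
      Real.norm_of_nonneg hh.le, norm_sub_rev]
    exact mul_le_mul_of_nonneg_left (hLip h hh.le) hh.le
  -- summation
  have hsplit : u (t₀ + h) (x + h • w) - u t₀ x =
      (u (t₀ + h) (x + h • w) - u t₀ (x + h • w) - h • deriv (fun s => u s (x + h • w)) t₀) +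
        (u t₀ (x + h • w) - u t₀ x - h • fderiv ℝ (u t₀) x w) +
        h • (deriv (fun s => u s (x + h • w)) t₀ + fderiv ℝ (u t₀) x w) := by
    rw [smul_add]; abel
  rw [hsplit]
  exact (norm_add₃_le.trans (add_le_add_three h1 h2 h3)).trans_eq (by ring)

/-- **Stability: Galilean closeness propagates to a window after `t₀`.** If
`‖u(t₀ + h, x + hw) - u(t₀, x)‖ ≤ A h²` for `0 < h ≤ h₀`, then `‖u(t, x) - u(t + h, x + hw)‖ ≤ 2Ah²`
for `t ∈ (t₀, t₀ + η)`, `0 < h ≤ h₁` (`η` independent of `h`): `u` and the space-time translate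
`u(· + h, · + hw)` solve the Oseen integral equation from `t₀` (translation covariance,
`heatExtension_comp_add_right`, `oseenDuhamel_comp_add_right`, `oseenDuhamel_translate`) with free
terms at distance `≤ Ah²` (maximum principle); then `exists_oseenMild_stability_window`. -/
theorem boost_stability_window
    (hsm : ContDiffOn ℝ (⊤ : ℕ∞) (uncurry u) (Iio 0 ×ˢ univ))
    (hmildO : ∀ s t : ℝ, s < t → t < 0 → ∀ x,
      u t x = heatExtension (u s) (t - s) x - oseenDuhamel 1 s u u t x)
    (hTI : HasTypeITimeDecay C u) {t₀ : ℝ} (ht₀ : t₀ < 0) (w : EuclideanSpace ℝ (Fin 3))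
    {A h₀ : ℝ} (hA : 0 ≤ A) (hh₀ : 0 < h₀) (hth₀ : t₀ + h₀ < 0)
    (hquad : ∀ h : ℝ, 0 < h → h ≤ h₀ → ∀ x, ‖u (t₀ + h) (x + h • w) - u t₀ x‖ ≤ A * h ^ 2) :
    ∃ η h₁ : ℝ, 0 < η ∧ t₀ + η < 0 ∧ 0 < h₁ ∧ ∀ h : ℝ, 0 < h → h ≤ h₁ →
      ∀ t ∈ Ioo t₀ (t₀ + η), ∀ x, ‖u t x - u (t + h) (x + h • w)‖ ≤ 2 * (A * h ^ 2) := by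
  have hC : 0 ≤ C := steadySlice_typeI_const_nonneg hTI
  have hcont : ContinuousOn (uncurry u) (Iio 0 ×ˢ univ) := hsm.continuousOn
  set M : ℝ := C / Real.sqrt (-(t₀ / 2)) with hM
  have hM0 : 0 ≤ M := div_nonneg hC (Real.sqrt_nonneg _)
  have hbdM : ∀ τ ≤ t₀ / 2, ∀ y, ‖u τ y‖ ≤ M := fun τ hτ y =>
    steadySlice_norm_le_of_hasTypeITimeDecay hTI hC (by linarith) hτ y
  obtain ⟨η, hη, hstab⟩ :=
    exists_oseenMild_stability_window (EuclideanSpace ℝ (Fin 3)) (ν := (1 : ℝ)) (M := M) one_pos hM0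
  set T : ℝ := 3 * t₀ / 4 with hT
  have ht₀T : t₀ < T := by rw [hT]; linarith
  have hT0 : T < 0 := by rw [hT]; linarith
  set h₁ : ℝ := min h₀ (-t₀ / 4) with hh₁
  have hh₁0 : 0 < h₁ := lt_min hh₀ (by linarith)
  have hh₁h₀ : h₁ ≤ h₀ := min_le_left _ _
  have hh₁q : h₁ ≤ -t₀ / 4 := min_le_right _ _
  set η' : ℝ := min η ((T - t₀) / 2) with hη'
  have hη'0 : 0 < η' := lt_min hη (by linarith)
  have hη'η : η' ≤ η := min_le_left _ _
  have hη'T : t₀ + η' < T := by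
    have : η' ≤ (T - t₀) / 2 := min_le_right _ _
    linarith
  refine ⟨η', h₁, hη'0, hη'T.trans hT0, hh₁0, fun h hh hhh₁ t ht x => ?_⟩
  have htT : t ∈ Ioo t₀ T := ⟨ht.1, ht.2.trans hη'T⟩
  have htη : t ≤ t₀ + η := by linarith [ht.2]
  have hTh : T + h ≤ t₀ / 2 := by rw [hT]; linarith
  have hvm : AEStronglyMeasurable (uncurry fun τ y => u (τ + h) (y + h • w))
      ((volume : Measure (ℝ × (EuclideanSpace ℝ (Fin 3)))).restrict (Ioo t₀ T ×ˢ univ)) := by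
    have hφ : Continuous fun p : ℝ × (EuclideanSpace ℝ (Fin 3)) => (p.1 + h, p.2 + h • w) :=
      by fun_prop
    have hmaps : MapsTo (fun p : ℝ × (EuclideanSpace ℝ (Fin 3)) => (p.1 + h, p.2 + h • w))
        (Ioo t₀ T ×ˢ univ) (Iio 0 ×ˢ univ) := by
      intro p hp
      obtain ⟨hp1, -⟩ := mem_prod.1 hp
      exact mk_mem_prod (by simp only [mem_Iio]; linarith [hp1.2]) (mem_univ _)
    exact (hcont.comp hφ.continuousOn hmaps).aestronglyMeasurable
      (measurableSet_Ioo.prod MeasurableSet.univ)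
  have hcv : Continuous fun y : EuclideanSpace ℝ (Fin 3) => u (t₀ + h) (y + h • w) :=
    (steadySlice_continuous_slice hsm (by linarith)).comp (continuous_id.add continuous_const)
  refine hstab (s := t₀) (T := T) (U := fun t x => heatExtension (u t₀) (t - t₀) x)
    (V := fun t x => heatExtension (fun y => u (t₀ + h) (y + h • w)) (t - t₀) x) (u := u)
    (v := fun τ y => u (τ + h) (y + h • w))
    ?_ hvm ?_ ?_ ?_ ?_ (by positivity) ?_ t htT htη x
  · exact (hcont.mono (prod_mono (fun τ hτ => (hτ.2.trans hT0 : τ < 0)) Subset.rfl)).aestronglyMeasurable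
      (measurableSet_Ioo.prod MeasurableSet.univ)
  · exact fun τ hτ y => hbdM τ (by linarith [hτ.2]) y
  · exact fun τ hτ y => hbdM (τ + h) (by linarith [hτ.2]) (y + h • w)
  · exact fun t ht x => hmildO t₀ t ht.1 (ht.2.trans hT0) x
  · intro t ht x
    show u (t + h) (x + h • w) = heatExtension (fun y => u (t₀ + h) (y + h • w)) (t - t₀) x -
      oseenDuhamel 1 t₀ (fun τ y => u (τ + h) (y + h • w)) (fun τ y => u (τ + h) (y + h • w)) t x
    rw [heatExtension_comp_add_right (u (t₀ + h)) (h • w) (t - t₀) x,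
      oseenDuhamel_comp_add_right 1 t₀ (fun τ => u (τ + h)) (fun τ => u (τ + h)) (h • w) t x,
      oseenDuhamel_translate 1 t₀ h u u t (x + h • w),
      hmildO (t₀ + h) (t + h) (by linarith [ht.1]) (by linarith [ht.2]) (x + h • w),
      add_sub_add_right_eq_sub]
  · intro t ht x
    have hts : 0 < t - t₀ := sub_pos.2 ht.1
    show ‖heatExtension (u t₀) (t - t₀) x -
        heatExtension (fun y => u (t₀ + h) (y + h • w)) (t - t₀) x‖ ≤ A * h ^ 2
    rw [← heatExtension_sub_of_bound (steadySlice_continuous_slice hsm ht₀) hcv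
      (fun z => hbdM t₀ (by linarith) z) (fun z => hbdM (t₀ + h) (by linarith) (z + h • w)) hts x]
    refine norm_heatExtension_le (fun z => ?_) hts x
    rw [norm_sub_rev]
    exact hquad h hh (hhh₁.trans hh₁h₀) z

/-- **The directional derivative `D(uncurry u)(t,x)(1,w)` vanishes where the Galilean difference
quotients are `O(h)`**: `h⁻¹(u(t+h, x+hw) - u(t,x))` tends (`h → 0⁺`) to the derivative at `0` of
`r ↦ uncurry u (t + r, x + rw)`, i.e. to `D(uncurry u)(t,x)(1,w)` (chain rule), and is `≤ 2Ah`. -/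
theorem boost_fderiv_uncurry_eq_zero
    (hsm : ContDiffOn ℝ (⊤ : ℕ∞) (uncurry u) (Iio 0 ×ˢ univ)) {t : ℝ} (ht : t < 0)
    (x w : EuclideanSpace ℝ (Fin 3)) {A h₁ : ℝ} (hh₁ : 0 < h₁)
    (hclose : ∀ h : ℝ, 0 < h → h ≤ h₁ → ‖u t x - u (t + h) (x + h • w)‖ ≤ 2 * (A * h ^ 2)) :
    fderiv ℝ (uncurry u) (t, x) (1, w) = 0 := by
  have hdiff : DifferentiableAt ℝ (uncurry u) (t, x) :=
    (hsm.differentiableOn (by simp)).differentiableAt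
      ((isOpen_Iio.prod isOpen_univ).mem_nhds (mk_mem_prod ht (mem_univ _)))
  have hcurve : HasDerivAt (fun r : ℝ => (t + r, x + r • w)) ((1 : ℝ), w) 0 := by
    refine ((hasDerivAt_id (0 : ℝ)).const_add t).prodMk ?_
    simpa using ((hasDerivAt_id (0 : ℝ)).smul_const w).const_add x
  have hγ : HasDerivAt (fun r : ℝ => uncurry u (t + r, x + r • w))
      (fderiv ℝ (uncurry u) (t, x) (1, w)) 0 :=
    hdiff.hasFDerivAt.comp_hasDerivAt_of_eq 0 hcurve (by simp)
  have hlim0 : Tendsto (fun r : ℝ => 2 * A * r) (𝓝[>] 0) (𝓝 0) :=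
    tendsto_nhdsWithin_of_tendsto_nhds
      ((continuous_const.mul continuous_id).tendsto' (0 : ℝ) 0 (by simp))
  have hle : ‖fderiv ℝ (uncurry u) (t, x) (1, w)‖ ≤ 0 := by
    refine le_of_tendsto_of_tendsto (tendsto_norm.comp hγ.tendsto_slope_zero_right) hlim0 ?_
    filter_upwards [Ioc_mem_nhdsGT hh₁] with r hr
    simp only [Function.comp_apply, zero_add, add_zero, zero_smul, uncurry_apply_pair]
    rw [norm_smul, norm_inv, Real.norm_of_nonneg hr.1.le, norm_sub_rev]
    calc r⁻¹ * ‖u t x - u (t + r) (x + r • w)‖ ≤ r⁻¹ * (2 * (A * r ^ 2)) :=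
          mul_le_mul_of_nonneg_left (hclose r hr.1 hr.2) (inv_nonneg.2 hr.1.le)
      _ = 2 * A * r := by field_simp
  exact norm_le_zero_iff.1 hle

/-- **Chain rule along a travelling-wave line**: for `s < 0`, the curve
`σ ↦ u(σ, x₀ + (σ - t₀)w)` has derivative `D(uncurry u)(s, x₀ + (s - t₀)w)(1, w)` at `s`. -/
theorem boost_hasDerivAt_wave (hsm : ContDiffOn ℝ (⊤ : ℕ∞) (uncurry u) (Iio 0 ×ˢ univ))
    (x₀ w : EuclideanSpace ℝ (Fin 3)) (t₀ : ℝ) {s : ℝ} (hs : s < 0) :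
    HasDerivAt (fun σ => u σ (x₀ + (σ - t₀) • w))
      (fderiv ℝ (uncurry u) (s, x₀ + (s - t₀) • w) (1, w)) s := by
  have hdiff : DifferentiableAt ℝ (uncurry u) (s, x₀ + (s - t₀) • w) :=
    (hsm.differentiableOn (by simp)).differentiableAt
      ((isOpen_Iio.prod isOpen_univ).mem_nhds (mk_mem_prod hs (mem_univ _)))
  have hcurve : HasDerivAt (fun σ : ℝ => (σ, x₀ + (σ - t₀) • w)) ((1 : ℝ), w) s := by
    refine (hasDerivAt_id s).prodMk ?_
    simpa using (((hasDerivAt_id s).sub_const t₀).smul_const w).const_add x₀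
  exact hdiff.hasFDerivAt.comp_hasDerivAt s hcurve

end Boost

/-! ### The stub -/

/-- **Stub `stub_boostLiouville` — one Galilean-steady instant kills a class element**: if `c₀√(-t₀) ∂ₜu(t₀,·) + ∂_b u(t₀,·) ≡ 0` with `c₀ ≠ 0` then `u ≡ 0` (travelling-wave twin of `SteadySliceLiouville`). With `w = b/(c₀√(-t₀))`: quadratic closeness of `u` and `u(· + h, · + hw)` at `t₀` (`boost_quadratic_closeness`: Dong–Zhang's bound on `∂ₜ²u` and KNSS Prop. 4.1 for `∇²u`), the stability window of bounded Oseen-mild solutions (`boost_stability_window`), hence `∂ₜu + ∂_w u = 0` shortly after `t₀` (`boost_fderiv_uncurry_eq_zero`); the travelling-wave curves `s ↦ u(s, x₀ + (s - t₀)w)` are real-analytic on `(-∞,0)` (`analyticOnNhd_uncurry_of_oseenMild`, Lemarié-Rieusset 2016 Thm. 9.12) and locally constant, hence constant, and the Type-I bound `C/√(-s) → 0` kills the constant. [DongZhang2020 Thm 2, LemarieRieusset2016 Thm 9.12, KNSS2009 §4] -/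
theorem stub_boostLiouville :
    ∀ (C : ℝ) (u : ℝ → EuclideanSpace ℝ (Fin 3) → EuclideanSpace ℝ (Fin 3)), ContDiffOn ℝ (⊤ : ℕ∞) (Function.uncurry u) (Set.Iio 0 ×ˢ Set.univ) ∧ (∀ t < 0, Literature.Analysis.FluidPDE.VectorCalculus.IsDivFree (u t)) ∧ (∀ s t : ℝ, s < t → t < 0 → ∀ x, u t x = Literature.Analysis.FluidPDE.heatFlow (u s) (t - s) x - ∫ τ in Set.Ioo s t, ∫ y, ((-(inner ℝ (x - y) (u τ y) / (2 * (t - τ)) * Literature.Analysis.UnboundedOperators.heatKernel (t - τ) (x - y))) • u τ y + (∫ σ in Set.Ioi (t - τ), Literature.Analysis.UnboundedOperators.heatKernel σ (x - y) / (4 * σ ^ 2)) • (inner ℝ (x - y) (u τ y) • u τ y + inner ℝ (u τ y) (u τ y) • (x - y) + inner ℝ (x - y) (u τ y) • u τ y) - ((∫ σ in Set.Ioi (t - τ), Literature.Analysis.UnboundedOperators.heatKernel σ (x - y) / (8 * σ ^ 3)) * (inner ℝ (x - y) (u τ y) * inner ℝ (x - y) (u τ y))) • (x - y))) ∧ Literature.Analysis.FluidPDE.HasTypeITimeDecay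 C u ∧ (∀ (x₀ : EuclideanSpace ℝ (Fin 3)) (t₀ r : ℝ), t₀ ≤ 0 → 0 < r → (∀ t, t₀ - r ^ 2 < t → t < t₀ → r⁻¹ * ∫ x in Metric.ball x₀ r, ‖u t x‖ ^ 2 ≤ C) ∧ r⁻¹ * ∫ t in Set.Ioo (t₀ - r ^ 2) t₀, ∫ x in Metric.ball x₀ r, ‖fderiv ℝ (u t) x‖ ^ 2 ≤ C) → ∀ t₀ : ℝ, t₀ < 0 → ∀ (c₀ : ℝ) (b : EuclideanSpace ℝ (Fin 3)), c₀ ≠ 0 → (∀ x, (c₀ * Real.sqrt (-t₀)) • Literature.Analysis.FluidPDE.timeDeriv u t₀ x + fderiv ℝ (u t₀) x b = 0) → ∀ t : ℝ, t < 0 → ∀ x, u t x = 0 := by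
  intro C u hu t₀ ht₀ c₀ b hc₀ hframe t ht x
  obtain ⟨hsm, hdiv, hmild, hTI, -⟩ := hu
  have hmildO : ∀ s t : ℝ, s < t → t < 0 → ∀ x,
      u t x = heatExtension (u s) (t - s) x - oseenDuhamel 1 s u u t x := by
    intro s t hst ht x
    rw [oseenDuhamel_one_eq_unfolded, ← heatFlow_of_pos (u s) (sub_pos.2 hst)]
    exact hmild s t hst ht x
  -- normalise the direction: `w = b / (c₀ √(-t₀))`, so that `∂ₜu(t₀,·) + ∂_w u(t₀,·) ≡ 0`
  set κ : ℝ := c₀ * Real.sqrt (-t₀) with hκ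
  have hκ0 : κ ≠ 0 := mul_ne_zero hc₀ (Real.sqrt_pos.2 (neg_pos.2 ht₀)).ne'
  set w : EuclideanSpace ℝ (Fin 3) := κ⁻¹ • b with hw
  have hbw : b = κ • w := by rw [hw, smul_smul, mul_inv_cancel₀ hκ0, one_smul]
  have H0 : ∀ y, deriv (fun s => u s y) t₀ + fderiv ℝ (u t₀) y w = 0 := by
    intro y
    have h1 := hframe y
    rw [timeDeriv_apply, hbw, map_smul, ← smul_add, smul_eq_zero] at h1
    exact h1.resolve_left hκ0
  -- Steps A and B: Galilean steadiness on a window after `t₀`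
  obtain ⟨A, h₀, hA, hh₀, hth₀, hquad⟩ := boost_quadratic_closeness hsm hdiv hmildO hTI ht₀ H0
  obtain ⟨η, h₁, hη, hη0, hh₁, hclose⟩ :=
    boost_stability_window hsm hmildO hTI ht₀ w hA hh₀ hth₀ hquad
  have H1 : ∀ s ∈ Ioo t₀ (t₀ + η), ∀ y, fderiv ℝ (uncurry u) (s, y) (1, w) = 0 :=
    fun s hs y => boost_fderiv_uncurry_eq_zero hsm (by linarith [hs.2]) y w hh₁
      (fun h hh hhh₁ => hclose h hh hhh₁ s hs y)
  -- Step C: the travelling-wave curve through `(t, x)` is analytic and constant on the window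
  have han := analyticOnNhd_uncurry_of_oseenMild hsm hmildO hTI
  set x₀ : EuclideanSpace ℝ (Fin 3) := x - (t - t₀) • w with hx₀
  set g : ℝ → EuclideanSpace ℝ (Fin 3) := fun σ => u σ (x₀ + (σ - t₀) • w) with hg
  have hg_an : AnalyticOnNhd ℝ g (Iio 0) := by
    intro σ hσ
    have h1 : AnalyticAt ℝ (uncurry u) (σ, x₀ + (σ - t₀) • w) :=
      han _ (mk_mem_prod hσ (mem_univ _))
    have h2 : AnalyticAt ℝ (fun σ : ℝ => (σ, x₀ + (σ - t₀) • w)) σ := by fun_prop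
    exact h1.comp_of_eq h2 rfl
  have hg_diff : DifferentiableOn ℝ g (Ioo t₀ (t₀ + η)) := fun σ hσ =>
    (boost_hasDerivAt_wave hsm x₀ w t₀ (by linarith [hσ.2])).differentiableAt.differentiableWithinAt
  have hg_der : (Ioo t₀ (t₀ + η)).EqOn (deriv g) 0 := fun σ hσ => by
    rw [(boost_hasDerivAt_wave hsm x₀ w t₀ (by linarith [hσ.2])).deriv]
    exact H1 σ hσ _
  set σ₀ : ℝ := t₀ + η / 2 with hσ₀
  have hσ₀mem : σ₀ ∈ Ioo t₀ (t₀ + η) := ⟨by rw [hσ₀]; linarith, by rw [hσ₀]; linarith⟩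
  have hσ₀0 : σ₀ < 0 := by rw [hσ₀]; linarith
  have heq : g =ᶠ[𝓝 σ₀] fun _ => g σ₀ := by
    filter_upwards [Ioo_mem_nhds hσ₀mem.1 hσ₀mem.2] with σ hσ using
      isOpen_Ioo.is_const_of_deriv_eq_zero isPreconnected_Ioo hg_diff hg_der hσ hσ₀mem
  have hU : ∀ σ : ℝ, σ < 0 → g σ = g σ₀ := fun σ hσ =>
    hg_an.eqOn_of_preconnected_of_eventuallyEq (fun _ _ => analyticAt_const) isPreconnected_Iio
      hσ₀0 heq hσ
  -- Step D: a travelling wave with Type-I decay vanishes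
  have hzero : g σ₀ = 0 := by
    have hC : 0 ≤ C := steadySlice_typeI_const_nonneg hTI
    by_contra hne
    have hpos : 0 < ‖g σ₀‖ := norm_pos_iff.2 hne
    set a : ℝ := C / ‖g σ₀‖ + 1 with ha_def
    have ha : 0 < a := by positivity
    have hs : -(a ^ 2) < 0 := by nlinarith
    have h1 : ‖g (-(a ^ 2))‖ ≤ C / a := by
      have h := hTI (-(a ^ 2)) hs (x₀ + (-(a ^ 2) - t₀) • w)
      rw [neg_neg, Real.sqrt_sq ha.le] at h
      exact h
    rw [hU _ hs] at h1
    have h2 : C / a < ‖g σ₀‖ := by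
      rw [div_lt_iff₀ ha, ha_def, mul_add, mul_one, mul_div_cancel₀ _ hpos.ne']
      linarith
    linarith
  have hgt : u t x = g t := by simp [hg, hx₀]
  rw [hgt, hU t ht, hzero]

end Summit.NavierStokesRegularity.NavierStokesRegularity.Theorems

end
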